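import Summits.HodgeConjecture.Statement
import Summits.HodgeConjecture.HodgeConjecture.Theorems.WeilTypeLadderSixfolds
import Summits.HodgeConjecture.HodgeConjecture.Theorems.WeilTypeLadderOnPath
import Summits.HodgeConjecture.HodgeConjecture.Theorems.SevenfoldWeilCensusAssembly
import HarnessLib

/-!
# WeilTypeLadderSixfoldsOnPath — on-path lemmas and arrows for R6 `AbelianSixfolds` / R7 `AbelianDimLeSeven`

b2b cell `hweil`, LADDER.md `## CARVER` v2.1 (R6 concordance: "HC for all abelian sixfolds = which rungs").
Everything here is PROVED (no `sorry`, no new axioms); the two nodes are the conjecture leaf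
`Theorems/WeilTypeLadderSixfolds.lean`.

* ON-PATH: `abelianDimLeSeven_of_hodgeConjecture`, `abelianSixfolds_of_hodgeConjecture` (instances of the summit).
* DOWN: `abelianSixfolds_of_abelianDimLeSeven` (`6 ≤ 7`), `weilSixfolds_of_abelianSixfolds` (R6 → R1: a Weil
  class of `(A, φ² = -d)`, `dim A = 6`, is a rational `(3,3)`-class, so `HodgeConjectureFor 6 A.X` makes it
  algebraic), hence `nonsplitSixfolds_of_abelianSixfolds` (R6 → R1′ through `nonsplitSixfolds_of_weilSixfolds`).
* UP (the reduction, BY NAME): `abelianDimLeSeven_of_census` is `Theorems.sevenfoldWeilCensus_assembly_proof`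
  (item stmt-HodgeConjecture-18724 of route `SevenfoldWeilCensus`, proved @ 674f8bd141e6) read at its unfolded
  type `CodimTwoFromLowerDim → CodimThreeWeilGeneration → WeilSixfolds → HodgeAbelianDimLeFive → AbelianDimLeSeven`;
  `abelianSixfolds_of_census` restricts it to sixfolds. The census hypotheses (stmt-18721, stmt-18720) are
  Hodge-theoretic generation statements — X1 (stmt-18720) OPEN; **X2 (stmt-18721) REFUTED AT EVIDENCE LEVEL
  (2026-08-18)** by the CM sixfold `B × E′ × E″` inside `ℚ(ζ₂₄)` (`dim B² = 19 = 15 + 4`; packet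
  `b2b-hweil-carver-g2/x2-refutation-evidence.md`, kernel census `Literature/…/PohlmannSetsZeta24ProductSixfold`,
  p176557; the item stays formally `open`, DIVERGENCE D11), so the UP theorems below are IMPLICATIONS WITH A FALSE
  ANTECEDENT, retained as implications and not as a plan (STATUS UPDATE in `Theorems/WeilTypeLadderSixfolds.lean`;
  the witness's exceptional classes are algebraic mod [Aoki 2002], `Theorems/WeilTypeLadderFermatTwentyFour.lean`,
  p177003) —, the floor `HodgeAbelianDimLeFive` is the cite-only named fact
  `Markman2025_hodgeClasses_algebraic_abelian_dim_le_five` (UNREFEREED preprint arXiv:2502.03415, Cor. 1.3, with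
  Moonen–Zarhin 1999): every consequence is conditional on them and says so in its hypotheses.
-/

-- every declaration of this problem lives in `Summit.HodgeConjecture.HodgeConjecture.…` (summit = sub-problem)
set_option linter.dupNamespace false

noncomputable section

open CategoryTheory

namespace Summit.HodgeConjecture.HodgeConjecture.WeilTypeLadder

open Literature.AlgebraicGeometry Literature.AlgebraicGeometry.Motives
open Literature.AlgebraicGeometry.HodgeTheory
open Literature.AlgebraicTopology.SingularHomology

/-! ### On-path lemmas -/

/-- ON-PATH (R7): `HodgeConjecture → AbelianDimLeSeven` — the node is the summit restricted to abelian
varieties of dimension `≤ 7`. -/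
theorem abelianDimLeSeven_of_hodgeConjecture (h : _root_.HodgeConjecture) : AbelianDimLeSeven :=
  fun _ _ hX ↦ h hX

/-- DOWN (R7 → R6): a sixfold has dimension `≤ 7`. -/
theorem abelianSixfolds_of_abelianDimLeSeven (h : AbelianDimLeSeven) : AbelianSixfolds :=
  fun A hA hX ↦ h A (by omega) hX

/-- ON-PATH (R6): `HodgeConjecture → AbelianSixfolds`. -/
theorem abelianSixfolds_of_hodgeConjecture (h : _root_.HodgeConjecture) : AbelianSixfolds :=
  abelianSixfolds_of_abelianDimLeSeven (abelianDimLeSeven_of_hodgeConjecture h)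

/-! ### R6 → R1 → R1′ -/

/-- DOWN (R6 → R1): HC for all abelian sixfolds gives the shared crux `WeilSixfolds`
(stmt-HodgeConjecture-2524): the Weil class is a rational `(3,3)`-class on a smooth projective sixfold. -/
theorem weilSixfolds_of_abelianSixfolds (h : AbelianSixfolds) : Theses.SevenfoldWeilCensus.WeilSixfolds := by
  intro d _ A φ hA hsp _ c hc hct _
  have hA6 : A.dim = 6 := by omega
  have hsp' : IsSmoothProjective A.dim A.X := by rw [hA6]; exact hsp
  obtain ⟨-, H⟩ := h A hA6 hsp'
  have hct' : IsOfHodgeType A.dim A.X (2 * 3) 3 3 c := by rw [hA6]; exact hct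
  exact H 3 c hc hct'

/-- DOWN (R6 → R1′): through `nonsplitSixfolds_of_weilSixfolds`. -/
theorem nonsplitSixfolds_of_abelianSixfolds (h : AbelianSixfolds) : NonsplitSixfolds :=
  nonsplitSixfolds_of_weilSixfolds (weilSixfolds_of_abelianSixfolds h)

/-! ### The reduction (census ∧ R1 ∧ floor → R7 → R6), by name -/

/-- UP: the SEVENFOLD REDUCTION of route `SevenfoldWeilCensus` (assembly item stmt-HodgeConjecture-18724, proved
as `Theorems.sevenfoldWeilCensus_assembly_proof`) at its unfolded type: the two census cruxes (codimension 2: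
stmt-18721; codimension 3: stmt-18720), rung R1 and the dim `≤ 5` floor give HC for every complex abelian
variety of dimension `≤ 7`. IMPLICATION ONLY: the hypothesis `h₃` (X2, stmt-18721) is refuted at evidence
level (2026-08-18, module docstring). -/
theorem abelianDimLeSeven_of_census
    (h₃ : Theses.SevenfoldWeilCensus.CodimTwoFromLowerDim)
    (h₂ : Theses.SevenfoldWeilCensus.CodimThreeWeilGeneration)
    (h₄ : Theses.SevenfoldWeilCensus.WeilSixfolds)
    (h₅ : Theses.SevenfoldWeilCensus.HodgeAbelianDimLeFive) : AbelianDimLeSeven :=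
  fun A hA hX ↦ Theorems.sevenfoldWeilCensus_assembly_proof h₃ h₂ h₄ h₅ A hA hX

/-- UP, restricted to sixfolds: "HC for ALL abelian sixfolds" from the census cruxes, R1 and the floor. -/
theorem abelianSixfolds_of_census
    (h₃ : Theses.SevenfoldWeilCensus.CodimTwoFromLowerDim)
    (h₂ : Theses.SevenfoldWeilCensus.CodimThreeWeilGeneration)
    (h₄ : Theses.SevenfoldWeilCensus.WeilSixfolds)
    (h₅ : Theses.SevenfoldWeilCensus.HodgeAbelianDimLeFive) : AbelianSixfolds :=
  abelianSixfolds_of_abelianDimLeSeven (abelianDimLeSeven_of_census h₃ h₂ h₄ h₅)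

/-- The same with R1 supplied by the summit-side chain `R1′ ∧ F2 → R1` (`weilSixfolds_of_nonsplitSixfolds_of_floor`
lives in `WeilTypeLadderOnPath`; here only the census form with `WeilSixfolds` itself is recorded) and the floor
read through `WeilClassesImaginaryQuadratic` (R∞ → dim ≤ 5 via the Moonen–Zarhin named reduction fact):
R∞ ∧ census ⇒ R7, conditional on `MoonenZarhin1999_hodgeClasses_abelian_dim_le_five_of_weilClassesFourfolds`. -/
theorem abelianDimLeSeven_of_census_of_weilClassesImaginaryQuadratic_of_moonenZarhin
    (hMZ : MoonenZarhin1999_hodgeClasses_abelian_dim_le_five_of_weilClassesFourfolds)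
    (h₃ : Theses.SevenfoldWeilCensus.CodimTwoFromLowerDim)
    (h₂ : Theses.SevenfoldWeilCensus.CodimThreeWeilGeneration)
    (h : WeilClassesImaginaryQuadratic) : AbelianDimLeSeven :=
  abelianDimLeSeven_of_census h₃ h₂ (weilSixfolds_of_weilClassesImaginaryQuadratic h)
    (floorDimLeFive_of_weilClassesImaginaryQuadratic_of_moonenZarhin hMZ h)

end Summit.HodgeConjecture.HodgeConjecture.WeilTypeLadder

end
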